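import Summits.Langlands.Langlands.Theses.DyadicOddResidue
import Summits.Langlands.Langlands.Theorems.DyadicOddResidueSectorComplementRigidityTransport
import Summits.Langlands.Langlands.Theorems.PhantomRMYoshidaPhantomRMJunctionGenericRigidity
import Summits.Langlands.Langlands.Theorems.PhantomRMYoshidaPhantomRMJunctionInvariantMeasureGLQuot
import Summits.Langlands.Langlands.Theorems.PhantomRMYoshidaPhantomRMJunctionOfR
import Literature.NumberTheory.Automorphic.LocalLanglandsGLIndecomposable
import Literature.NumberTheory.GaloisRepresentations.HenniartGaloisSideCharacterisation
import HarnessLib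

/-!
# Route DyadicOddResidue — `SectorComplement` (stmt-Langlands-18745): the junction modulo the NAMED FACTS of
print, and its sandwich by the item `ReciprocityUpToIrreducibilityR` (stmt-Langlands-17925) — item-level certificate
(line `Sketch_18745_r1_k1`, idea `reciprocity-rigidity`, lead prover-line-stmt-Langlands-18745-c1-0, cycle 2;
`--supports` file: no `sorry`, no definition, axioms `propext` / `Classical.choice` / `Quot.sound`)

`SectorComplement := X → _root_.Langlands` (`X = OddRegularReciprocityQ`, inlined) is the route's frame item
("the rest of the summit"; `Langlands ↔ X ∧ SectorComplement`, landed p144479).  The line reduces it to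
R ∧ S7, where R = rigidity of PINNED reciprocity data on the local components of cuspidal automorphic
representations and S7 = the `∃ 𝓡` form of the junction, `X → Langlands_∃`
(`sectorComplement_of_rigid_of_junction` / `junctionExists_of_sectorComplement`, landed p145687).  This module
records, kernel-checked, where the crux's open content lives after cycle 2:

* `recRigidityOnLocalComponents_of_namedFacts` — R from the three named facts of print BY NAME:
  (F1) `localLanglands_gl` (Harris–Taylor 2001 Thm A + Henniart 1993 Thm 1.1), (F2)
  `localLanglands_gl_indecomposable` (Henniart 2002 Thm 1.5 (i), §2.7, §2.9; Zelevinsky 1980 Thm 9.7), (F3)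
  `Henniart2002_isEquivalent_of_rootMultiplicity_eulerFactor_tprod_eq` (Henniart 2002 Thm 1.7 (a)), each at every
  non-archimedean local field — through the landed every-rank generic rigidity
  `PhantomRMJunctionOfPieces.recGL_eq_of_isGeneric_of_namedFacts` (p157386) whose fourth input, the invariant
  measures on `GL_m(F) ⧸ U_m(F)`, is DISCHARGED (`PhantomRMJunctionOfPieces.stub_exists_smulInvariantMeasure_glQuotUpperUnitriangular`,
  from p158762), and genericity of local components (`CuspidalAutomorphicRepData.exists_isGeneric_of_hasLocalComponentAt`);
* `langlands_iff_langlandsExists_of_namedFacts` — granted F1–F3, `Langlands ↔ Langlands_∃`: the 2026-08-16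
  re-type `∃ 𝓡 ↦ Nonempty ∧ ∀ 𝓡` of the summit costs nothing beyond printed local facts (usable by every
  frame item of the sub);
* `sectorComplement_iff_junctionExists_of_namedFacts` — granted F1–F3, `SectorComplement ↔ (X → Langlands_∃)`:
  the line closes the crux EXACTLY modulo its junction stub S7;
* `sectorComplement_of_reciprocityUpToIrreducibilityR_text_of_JS`,
  `reciprocityUpToIrreducibilityR_text_of_sectorComplement`, `sectorComplement_iff_reciprocityUpToIrreducibilityR_text`,
  `langlandsExists_of_reciprocityUpToIrreducibilityR_text_of_JS` — the SANDWICH by existing items: the texts of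
  stmt-Langlands-17925 (reciprocity up to irreducibility for every pinned datum, with the non-vacuity conjunct;
  written out verbatim), stmt-Langlands-13622 `AnalyticDescent.PairLBoundaryJS` and stmt-Langlands-19093
  `AnalyticDescent.PairLPoleJS` (Arthur–Clozel (2.2)/(2.3)) give the crux, hence S7, with the sector X IDLE
  (honesty caveat: a frame item cannot consume its sector non-vacuously), through the landed
  `PhantomRMYoshidaJunctionOfR.langlands_of_reciprocityUpToIrreducibilityR_text_of_JS`; conversely the crux and
  X give the text of 17925.  So under X and JS the crux IS item 17925: nothing at crux level can move before it.

References: G. Henniart, Invent. Math. 113 (1993), Thm. 1.1 [Henniarts1993]; G. Henniart, Bull. SMF 130 (2002),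
Thm. 1.5, Thm. 1.7 (a) [HenniartBSMF2002]; M. Harris, R. Taylor, Ann. Math. Stud. 151 (2001), Thm. A
[HarrisTaylorAMS2001]; K. Buzzard, T. Gee, LMS LNS 414 (2014), Conj. 3.2.1–3.2.2 [BuzzardGeeLMS2014];
J.-M. Fontaine, B. Mazur (1995), Conj. 1 [FontaineMazurGeometric1995]; J. Arthur, L. Clozel, Ann. Math. Stud.
120, Ch. 3 §2 (2.2)–(2.3) [ArthurClozelAMS120]; J. A. Shalika, Ann. of Math. 100 (1974), Thm. 5.5 [Shalika1974].
-/

noncomputable section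

set_option linter.dupNamespace false -- project-wide option; `Summit.Langlands.Langlands` is the mandated namespace

open scoped MatrixGroups NumberField
open NumberField IsDedekindDomain Filter MeasureTheory
open Literature.NumberTheory.Automorphic Literature.NumberTheory.GaloisRepresentations
open Summit.Langlands
open Summit.Langlands.Langlands.Theses
open Summit.Langlands.Langlands.Theses.DyadicOddResidue

namespace Summit.Langlands.Langlands.Theorems.ReciprocityRigidity

/-! ## §1 R from the three named facts of print -/

/-- **Rigidity of pinned reciprocity data on the local components of cuspidal automorphic representations,
every rank, from the named facts (F1) `localLanglands_gl`, (F2) `localLanglands_gl_indecomposable`, (F3)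
`Henniart2002_isEquivalent_of_rootMultiplicity_eulerFactor_tprod_eq`** (each at every non-archimedean local
field; the invariant-measure input of the generic rigidity theorem is discharged in tree, and local components
of cuspidal `π` are generic). [cite: HenniartBSMF2002, Thm. 1.5 and Thm. 1.7 (a)] [cite: Henniarts1993, Thm 1.1]
[cite: Shalika1974, Thm 5.5] -/
theorem recRigidityOnLocalComponents_of_namedFacts
    (hF1 : ∀ (F : Type) [Field F] [ValuativeRel F] [TopologicalSpace F] [IsNonarchimedeanLocalField F]
      (hmul : @IsFrobPow.mul F _ _ _ _) (huniq : @IsFrobPow.unique F _ _ _ _)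
      (hn : absInertia_normal F) (hex : @exists_isFrobPow F _ _ _ _)
      (hns : @WeilGroup.exists_subgroup_le_inertia_isOpen_of_continuous F _ _ _ _)
      (d : LocalArtinData F) (𝓔 : LocalEpsilonSystem F) (hd : 𝓔.artin F = d),
      localLanglands_gl F hmul huniq hn hex hns d 𝓔 hd)
    (hF2 : ∀ (F : Type) [Field F] [ValuativeRel F] [TopologicalSpace F] [IsNonarchimedeanLocalField F]
      (hmul : @IsFrobPow.mul F _ _ _ _) (huniq : @IsFrobPow.unique F _ _ _ _)
      (hn : absInertia_normal F) (hex : @exists_isFrobPow F _ _ _ _)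
      (hns : @WeilGroup.exists_subgroup_le_inertia_isOpen_of_continuous F _ _ _ _)
      (d : LocalArtinData F) (𝓔 : LocalEpsilonSystem F) (hd : 𝓔.artin F = d),
      localLanglands_gl_indecomposable F hmul huniq hn hex hns d 𝓔 hd)
    (hF3 : ∀ (F : Type) [Field F] [ValuativeRel F] [TopologicalSpace F] [IsNonarchimedeanLocalField F],
      Henniart2002_isEquivalent_of_rootMultiplicity_eulerFactor_tprod_eq F) :
    ∀ (K : Type) [Field K] [NumberField K] (𝓡 𝓡' : ReciprocityData K) (n : ℕ)
      (hcpt : isCompact_glFiniteIntegralLevel n K), 0 < n →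
      ∀ (π : CuspidalAutomorphicRepData n K hcpt) (v : HeightOneSpectrum (𝓞 K))
        (πv : SmoothIrrep (GL (Fin n) (v.adicCompletion K))), π.1.HasLocalComponentAt v πv.ρ →
          (𝓡.llc v).recGL n (IrrClass.mk πv) = (𝓡'.llc v).recGL n (IrrClass.mk πv) := by
  intro K _ _ 𝓡 𝓡' n hcpt hn π v πv hπv
  haveI : NeZero n := ⟨hn.ne'⟩
  obtain ⟨ψ, hψ, hg⟩ := π.exists_isGeneric_of_hasLocalComponentAt v πv.ρ πv.isSmooth hπv
  exact PhantomRMJunctionOfPieces.recGL_eq_of_isGeneric_of_namedFacts hF1 hF2 hF3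
    PhantomRMJunctionOfPieces.stub_exists_smulInvariantMeasure_glQuotUpperUnitriangular
    K 𝓡 𝓡' v n πv ψ hψ hg

/-! ## §2 The rigidity dividend: `Langlands ↔ Langlands_∃` and the crux modulo its junction stub -/

/-- **Granted the three named local facts, the re-typed summit (`∀ 𝓡`) is equivalent to its `∃ 𝓡` form**
(`Langlands_∃ := ∀ F, ∃ 𝓡, ∀ n > 0, ∀ hcpt, (A) ∧ (B)`, spelled out): the landed
`langlands_iff_exists_of_rigid` fed by `recRigidityOnLocalComponents_of_namedFacts`.
[cite: Henniarts1993, Thm 1.1] [cite: HenniartBSMF2002, Thm. 1.5 and Thm. 1.7 (a)] -/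
theorem langlands_iff_langlandsExists_of_namedFacts
    (hF1 : ∀ (F : Type) [Field F] [ValuativeRel F] [TopologicalSpace F] [IsNonarchimedeanLocalField F]
      (hmul : @IsFrobPow.mul F _ _ _ _) (huniq : @IsFrobPow.unique F _ _ _ _)
      (hn : absInertia_normal F) (hex : @exists_isFrobPow F _ _ _ _)
      (hns : @WeilGroup.exists_subgroup_le_inertia_isOpen_of_continuous F _ _ _ _)
      (d : LocalArtinData F) (𝓔 : LocalEpsilonSystem F) (hd : 𝓔.artin F = d),
      localLanglands_gl F hmul huniq hn hex hns d 𝓔 hd)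
    (hF2 : ∀ (F : Type) [Field F] [ValuativeRel F] [TopologicalSpace F] [IsNonarchimedeanLocalField F]
      (hmul : @IsFrobPow.mul F _ _ _ _) (huniq : @IsFrobPow.unique F _ _ _ _)
      (hn : absInertia_normal F) (hex : @exists_isFrobPow F _ _ _ _)
      (hns : @WeilGroup.exists_subgroup_le_inertia_isOpen_of_continuous F _ _ _ _)
      (d : LocalArtinData F) (𝓔 : LocalEpsilonSystem F) (hd : 𝓔.artin F = d),
      localLanglands_gl_indecomposable F hmul huniq hn hex hns d 𝓔 hd)
    (hF3 : ∀ (F : Type) [Field F] [ValuativeRel F] [TopologicalSpace F] [IsNonarchimedeanLocalField F],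
      Henniart2002_isEquivalent_of_rootMultiplicity_eulerFactor_tprod_eq F) :
    _root_.Langlands ↔
      ∀ (F : Type) [Field F] [NumberField F], ∃ 𝓡 : ReciprocityData F, ∀ n : ℕ, 0 < n →
        ∀ hcpt : isCompact_glFiniteIntegralLevel n F, GlobalLanglandsCorrespondenceGLn n F 𝓡 hcpt :=
  langlands_iff_exists_of_rigid (recRigidityOnLocalComponents_of_namedFacts hF1 hF2 hF3)

/-- **The line certificate: granted the three named local facts, the crux is EQUIVALENT to its junction stub
S7** (`X → Langlands_∃`): `→` is free (`junctionExists_of_sectorComplement`), `←` is the transfer along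
rigid data (`sectorComplement_of_rigid_of_junction`).  The crux therefore closes on this line exactly when
S7 does; S7 is the reciprocity conjecture off the sector and is not claimed.
[cite: BuzzardGeeLMS2014, Conj. 3.2.1 and Conj. 3.2.2] [cite: FontaineMazurGeometric1995, Conj. 1] -/
theorem sectorComplement_iff_junctionExists_of_namedFacts
    (hF1 : ∀ (F : Type) [Field F] [ValuativeRel F] [TopologicalSpace F] [IsNonarchimedeanLocalField F]
      (hmul : @IsFrobPow.mul F _ _ _ _) (huniq : @IsFrobPow.unique F _ _ _ _)
      (hn : absInertia_normal F) (hex : @exists_isFrobPow F _ _ _ _)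
      (hns : @WeilGroup.exists_subgroup_le_inertia_isOpen_of_continuous F _ _ _ _)
      (d : LocalArtinData F) (𝓔 : LocalEpsilonSystem F) (hd : 𝓔.artin F = d),
      localLanglands_gl F hmul huniq hn hex hns d 𝓔 hd)
    (hF2 : ∀ (F : Type) [Field F] [ValuativeRel F] [TopologicalSpace F] [IsNonarchimedeanLocalField F]
      (hmul : @IsFrobPow.mul F _ _ _ _) (huniq : @IsFrobPow.unique F _ _ _ _)
      (hn : absInertia_normal F) (hex : @exists_isFrobPow F _ _ _ _)
      (hns : @WeilGroup.exists_subgroup_le_inertia_isOpen_of_continuous F _ _ _ _)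
      (d : LocalArtinData F) (𝓔 : LocalEpsilonSystem F) (hd : 𝓔.artin F = d),
      localLanglands_gl_indecomposable F hmul huniq hn hex hns d 𝓔 hd)
    (hF3 : ∀ (F : Type) [Field F] [ValuativeRel F] [TopologicalSpace F] [IsNonarchimedeanLocalField F],
      Henniart2002_isEquivalent_of_rootMultiplicity_eulerFactor_tprod_eq F) :
    SectorComplement ↔
      (OddRegularReciprocityQ →
        ∀ (F : Type) [Field F] [NumberField F], ∃ 𝓡 : ReciprocityData F, ∀ n : ℕ, 0 < n →
          ∀ hcpt : isCompact_glFiniteIntegralLevel n F, GlobalLanglandsCorrespondenceGLn n F 𝓡 hcpt) :=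
  ⟨junctionExists_of_sectorComplement,
    sectorComplement_of_rigid_of_junction (recRigidityOnLocalComponents_of_namedFacts hF1 hF2 hF3)⟩

/-! ## §3 The sandwich by the item `ReciprocityUpToIrreducibilityR` (stmt-Langlands-17925) -/

/-- **SUFFICIENCY — the crux from the texts of items stmt-Langlands-17925, 13622, 19093** (the sector
hypothesis X is discarded: the three texts give the summit itself,
`PhantomRMYoshidaJunctionOfR.langlands_of_reciprocityUpToIrreducibilityR_text_of_JS`).
[cite: BuzzardGeeLMS2014, Conj. 3.2.1 and Conj. 3.2.2] [cite: ArthurClozelAMS120, Ch. 3 §2 (2.2)–(2.3)] -/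
theorem sectorComplement_of_reciprocityUpToIrreducibilityR_text_of_JS
    (h22 : AnalyticDescent.PairLBoundaryJS) (h23 : AnalyticDescent.PairLPoleJS)
    (hR : ∀ (F : Type) [Field F] [NumberField F], Nonempty (ReciprocityData F) ∧
      ∀ (Rec : ReciprocityData F) (n : ℕ), 0 < n →
        ∀ hcpt : isCompact_glFiniteIntegralLevel n F,
          (∀ π : CuspidalAutomorphicRepData n F hcpt, π.1.IsLAlgebraic →
            ∀ (ℓ : ℕ) [Fact ℓ.Prime] (ι : PadicAlgCl ℓ ≃+* ℂ),
              ∃ ρ : FramedGaloisRep F (PadicAlgCl ℓ) n,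
                IsGeometricFramed Rec ρ ∧ Corresponds Rec ι π.1 ρ) ∧ GaloisToAutomorphic n Rec hcpt) :
    SectorComplement :=
  fun _ => PhantomRMYoshidaJunctionOfR.langlands_of_reciprocityUpToIrreducibilityR_text_of_JS h22 h23 hR

/-- **NECESSITY under the route target** — the crux and X give the summit, hence the text of item
stmt-Langlands-17925 (reciprocity up to irreducibility for every pinned datum): the crux cannot close before
that item once the target holds. [folklore] -/
theorem reciprocityUpToIrreducibilityR_text_of_sectorComplement (hC : SectorComplement)
    (hX : OddRegularReciprocityQ) :
    ∀ (F : Type) [Field F] [NumberField F], Nonempty (ReciprocityData F) ∧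
      ∀ (Rec : ReciprocityData F) (n : ℕ), 0 < n →
        ∀ hcpt : isCompact_glFiniteIntegralLevel n F,
          (∀ π : CuspidalAutomorphicRepData n F hcpt, π.1.IsLAlgebraic →
            ∀ (ℓ : ℕ) [Fact ℓ.Prime] (ι : PadicAlgCl ℓ ≃+* ℂ),
              ∃ ρ : FramedGaloisRep F (PadicAlgCl ℓ) n,
                IsGeometricFramed Rec ρ ∧ Corresponds Rec ι π.1 ρ) ∧ GaloisToAutomorphic n Rec hcpt :=
  PhantomRMYoshidaJunctionOfR.reciprocityUpToIrreducibilityR_text_of_langlands (hC hX)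

/-- **Under the route target X and Arthur–Clozel (2.2)/(2.3), the crux IS the text of item
stmt-Langlands-17925** (sufficiency + necessity above).
[cite: BuzzardGeeLMS2014, Conj. 3.2.1 and Conj. 3.2.2] [cite: ArthurClozelAMS120, Ch. 3 §2 (2.2)–(2.3)] -/
theorem sectorComplement_iff_reciprocityUpToIrreducibilityR_text
    (h22 : AnalyticDescent.PairLBoundaryJS) (h23 : AnalyticDescent.PairLPoleJS)
    (hX : OddRegularReciprocityQ) :
    SectorComplement ↔
      ∀ (F : Type) [Field F] [NumberField F], Nonempty (ReciprocityData F) ∧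
        ∀ (Rec : ReciprocityData F) (n : ℕ), 0 < n →
          ∀ hcpt : isCompact_glFiniteIntegralLevel n F,
            (∀ π : CuspidalAutomorphicRepData n F hcpt, π.1.IsLAlgebraic →
              ∀ (ℓ : ℕ) [Fact ℓ.Prime] (ι : PadicAlgCl ℓ ≃+* ℂ),
                ∃ ρ : FramedGaloisRep F (PadicAlgCl ℓ) n,
                  IsGeometricFramed Rec ρ ∧ Corresponds Rec ι π.1 ρ) ∧ GaloisToAutomorphic n Rec hcpt :=
  ⟨fun hC => reciprocityUpToIrreducibilityR_text_of_sectorComplement hC hX,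
    sectorComplement_of_reciprocityUpToIrreducibilityR_text_of_JS h22 h23⟩

/-- **The junction stub S7 (indeed `Langlands_∃` outright) from the texts of items stmt-Langlands-17925,
13622, 19093** — what the line's one open stub waits on, in the tree: the summit from the three texts, then
a datum from its `Nonempty` conjunct and the clause from its `∀ 𝓡` conjunct.
[cite: BuzzardGeeLMS2014, Conj. 3.2.1 and Conj. 3.2.2] [cite: ArthurClozelAMS120, Ch. 3 §2 (2.2)–(2.3)] -/
theorem langlandsExists_of_reciprocityUpToIrreducibilityR_text_of_JS
    (h22 : AnalyticDescent.PairLBoundaryJS) (h23 : AnalyticDescent.PairLPoleJS)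
    (hR : ∀ (F : Type) [Field F] [NumberField F], Nonempty (ReciprocityData F) ∧
      ∀ (Rec : ReciprocityData F) (n : ℕ), 0 < n →
        ∀ hcpt : isCompact_glFiniteIntegralLevel n F,
          (∀ π : CuspidalAutomorphicRepData n F hcpt, π.1.IsLAlgebraic →
            ∀ (ℓ : ℕ) [Fact ℓ.Prime] (ι : PadicAlgCl ℓ ≃+* ℂ),
              ∃ ρ : FramedGaloisRep F (PadicAlgCl ℓ) n,
                IsGeometricFramed Rec ρ ∧ Corresponds Rec ι π.1 ρ) ∧ GaloisToAutomorphic n Rec hcpt) :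
    ∀ (F : Type) [Field F] [NumberField F], ∃ 𝓡 : ReciprocityData F, ∀ n : ℕ, 0 < n →
      ∀ hcpt : isCompact_glFiniteIntegralLevel n F, GlobalLanglandsCorrespondenceGLn n F 𝓡 hcpt := by
  intro F _ _
  obtain ⟨⟨𝓡⟩, hall⟩ :=
    PhantomRMYoshidaJunctionOfR.langlands_of_reciprocityUpToIrreducibilityR_text_of_JS h22 h23 hR F
  exact ⟨𝓡, hall 𝓡⟩

end Summit.Langlands.Langlands.Theorems.ReciprocityRigidity

end
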